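import Mathlib
import Summits.NavierStokesRegularity.NavierStokesRegularity.Theorems.FilamentSkeletonRssDefectColumnGateAzimuthalBlockTwoZoneLoop

/-!
# Route `FilamentSkeletonRss` · crux `TransverseReduction1AG` (stmt-NavierStokesRegularity-27853; A1L twin stmt-23297) · line
# `defect_column_gate_1AG/1AL` — the loop condition of `twoZone_sup_le` for large `Rc`, exponent `A = 3`

Helper file (`--supports stmt-NavierStokesRegularity-27853 --as helper`; seat ns-filament-s2aloc-p1 g2; note ARCHITECTURE-B2B3-s2aloc-g2.md v6 §8).
Companion of `twoZone_loop_large` (`A = 2`, file `…TwoZoneLoop`): the same statement with `u₀ := (12/γ)·log Rc`, `e^{γu₀/4} = Rc³`.  `A = 2` suffices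
for the loop inequality, but the final `N² ≤ sup(1+u)⁴(a²+b²)` absorption of the two-zone bound has coefficient `∝ Rc^{2−A}·poly(log Rc)`, so the
packaged resolvent bound uses `A = 3`.
HONEST FRAMING: elementary real inequalities serving an a-priori bound for ONE family of blocks of ONE linear MODEL operator of a hypothetical
blow-up route (MODEL rung, negative side); `WaistColumnGateLoc1A`, `TransverseReduction1AG/1AL` are neither proved nor refuted; nothing here
bears on NS regularity.
-/

set_option linter.dupNamespace false

noncomputable section

namespace Summit.NavierStokesRegularity.NavierStokesRegularity.Theorems.DefectColumnGate

open Set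

set_option maxHeartbeats 1000000 in
/-- **The loop condition holds for large `Rc` with `u₀ = (12/γ)·log Rc` (`E = e^{γu₀/4} = Rc³`, i.e. `A = 3` — the exponent needed for the
final `N² ≤ S` absorption, whose coefficient is `∝ Rc^{2−A}`).**  For `0 < γ`, `2 ≤ m` there is `R₀ ≥ 1` (explicit: `max(e⁸, e^{γ/8}, (4C(1+96/γ)⁴)²)`)
such that for `Rc ≥ R₀` the inner radius `u₀ = (12/γ)log Rc` satisfies `64/γ ≤ u₀`, `1 ≤ u₀`, `e^{γu₀/4} = Rc³`, and the smallness condition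
`hsmall` of `twoZone_loop_reduction`. -/
theorem twoZone_loop_large_three {γ m a₂ cφ a₁ : ℝ} (hγ : 0 < γ) (hm : 2 ≤ m)
    (ha₂ : a₂ = 20 / m * (4 * Real.pi * (γ + 1) + 4) + 1)
    (hcφ : cφ = 12 * (2 * (1 + 36 * γ ^ 2) + 81 * γ / 32 + 81 / 64))
    (ha₁ : a₁ = γ + 12 * a₂ * cφ) :
    ∃ R₀ : ℝ, 1 ≤ R₀ ∧ ∀ Rc : ℝ, R₀ ≤ Rc →
      64 / γ ≤ 12 / γ * Real.log Rc ∧ 1 ≤ 12 / γ * Real.log Rc ∧ Real.exp (γ * (12 / γ * Real.log Rc) / 4) = Rc ^ 3 ∧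
      240 * Real.pi * a₁ * cφ / m * (1 + 12 / γ * Real.log Rc) ^ 3 / Rc
        + 15 * a₁ * γ ^ 2 / (2 * m ^ 2) * (1 + 12 / γ * Real.log Rc) ^ 4 / Real.exp (γ * (12 / γ * Real.log Rc) / 4)
        + Rc * (1 + 12 / γ * Real.log Rc) / (55296 * Real.pi * m * Real.exp (γ * (12 / γ * Real.log Rc) / 4)) ≤ 1 / 4 := by
  have hπ : 0 < Real.pi := Real.pi_pos
  have hm0 : 0 < m := by linarith
  have ha₂0 : 0 < a₂ := by rw [ha₂]; positivity
  have hcφ0 : 0 < cφ := by rw [hcφ]; positivity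
  have ha₁0 : 0 < a₁ := by rw [ha₁]; positivity
  -- the constant
  set C : ℝ := 240 * Real.pi * a₁ * cφ / m + 15 * a₁ * γ ^ 2 / (2 * m ^ 2) + 1 / (55296 * Real.pi * m) with hCdef
  have hC0 : 0 < C := by positivity
  set B : ℝ := 4 * C * (1 + 96 / γ) ^ 4 with hBdef
  have hB0 : 0 < B := by positivity
  refine ⟨max (max (Real.exp 8) (Real.exp (γ / 8))) (B ^ 2), ?_, ?_⟩
  · have : (1:ℝ) ≤ Real.exp 8 := Real.one_le_exp (by norm_num)
    exact le_trans this (le_trans (le_max_left _ _) (le_max_left _ _))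
  intro Rc hRc
  have hRc8 : Real.exp 8 ≤ Rc := le_trans (le_trans (le_max_left _ _) (le_max_left _ _)) hRc
  have hRcγ : Real.exp (γ / 8) ≤ Rc := le_trans (le_trans (le_max_right _ _) (le_max_left _ _)) hRc
  have hRcB : B ^ 2 ≤ Rc := le_trans (le_max_right _ _) hRc
  have hRc0 : 0 < Rc := lt_of_lt_of_le (Real.exp_pos _) hRc8
  have hRc1 : 1 ≤ Rc := le_trans (Real.one_le_exp (by norm_num)) hRc8
  -- the logarithm
  set L : ℝ := Real.log Rc with hLdef
  have hL8 : 8 ≤ L := by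
    rw [hLdef, ← Real.log_exp 8]; exact Real.log_le_log (Real.exp_pos _) hRc8
  have hLγ : γ / 8 ≤ L := by
    rw [hLdef, ← Real.log_exp (γ / 8)]; exact Real.log_le_log (Real.exp_pos _) hRcγ
  have hL0 : 0 ≤ L := by linarith
  set u₀ : ℝ := 12 / γ * L with hu₀def
  have hγi : 0 < 1 / γ := by positivity
  have hu₀64 : 64 / γ ≤ u₀ := by
    rw [hu₀def]
    have e : 64 / γ = 8 * (1 / γ) * 8 := by ring
    have e2 : 12 / γ * L = 12 * (1 / γ) * L := by ring
    rw [e, e2]; nlinarith [hL8, hγi]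
  have hu₀1 : 1 ≤ u₀ := by
    rw [hu₀def]
    have e : (1:ℝ) = 8 / γ * (γ / 8) := by field_simp
    have h1 : 8 / γ * (γ / 8) ≤ 8 / γ * L := mul_le_mul_of_nonneg_left hLγ (by positivity)
    have h2 : 8 / γ * L ≤ 12 / γ * L := by
      have e2 : 12 / γ * L - 8 / γ * L = 4 * (1 / γ) * L := by ring
      nlinarith [hL0, hγi, e2]
    linarith [h1, h2, e]
  have hu₀0 : 0 ≤ u₀ := by linarith
  -- `E = Rc³`
  have hE : Real.exp (γ * u₀ / 4) = Rc ^ 3 := by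
    rw [hu₀def]
    have e : γ * (12 / γ * L) / 4 = L + L + L := by field_simp; ring
    rw [e, Real.exp_add, Real.exp_add, hLdef, Real.exp_log hRc0]; ring
  refine ⟨hu₀64, hu₀1, hE, ?_⟩
  rw [hE]
  -- `P := 1 + u₀ ≤ (1 + 96/γ)·√√√Rc`, `P⁴ ≤ (1+96/γ)⁴ √Rc`
  set P : ℝ := 1 + u₀ with hPdef
  have hP1 : 1 ≤ P := by rw [hPdef]; linarith
  set q : ℝ := Real.sqrt (Real.sqrt (Real.sqrt Rc)) with hqdef
  have hq1 : 1 ≤ q := by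
    rw [hqdef]
    have h1 : 1 ≤ Real.sqrt Rc := by rw [← Real.sqrt_one]; exact Real.sqrt_le_sqrt hRc1
    have h2 : 1 ≤ Real.sqrt (Real.sqrt Rc) := by rw [← Real.sqrt_one]; exact Real.sqrt_le_sqrt h1
    rw [← Real.sqrt_one]; exact Real.sqrt_le_sqrt h2
  have hLq : L ≤ 8 * q := by rw [hLdef, hqdef]; exact log_le_eight_mul_sqrt_sqrt_sqrt hRc0
  have hPq : P ≤ (1 + 96 / γ) * q := by
    rw [hPdef, hu₀def]
    have h1 : 12 / γ * L ≤ 12 / γ * (8 * q) := mul_le_mul_of_nonneg_left hLq (by positivity)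
    have h2 : (1:ℝ) ≤ 1 * q := by linarith
    have e : (1 + 96 / γ) * q = 1 * q + 12 / γ * (8 * q) := by ring
    linarith [h1, h2, e]
  have hq4 : q ^ 4 = Real.sqrt Rc := by rw [hqdef]; exact sqrt_sqrt_sqrt_pow_four Rc
  have hP4 : P ^ 4 ≤ (1 + 96 / γ) ^ 4 * Real.sqrt Rc := by
    have h1 := pow_le_pow_left₀ (by linarith) hPq 4
    rw [mul_pow, hq4] at h1; exact h1
  have hsq0 : 0 < Real.sqrt Rc := Real.sqrt_pos.mpr hRc0
  have hsqB : B ≤ Real.sqrt Rc := by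
    have := Real.sqrt_le_sqrt hRcB
    rw [Real.sqrt_sq hB0.le] at this; exact this
  -- each term `≤ Cᵢ P⁴ / Rc`
  have hRc2 : Rc ≤ Rc ^ 3 := by
    have := pow_le_pow_right₀ hRc1 (show 1 ≤ 3 by norm_num); rw [pow_one] at this; exact this
  have hP34 : P ^ 3 ≤ P ^ 4 := by
    have := pow_le_pow_right₀ hP1 (show 3 ≤ 4 by norm_num); exact this
  have hP14 : P ≤ P ^ 4 := by
    have := pow_le_pow_right₀ hP1 (show 1 ≤ 4 by norm_num); rw [pow_one] at this; exact this
  have hP0 : 0 < P := by linarith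
  have ht1 : 240 * Real.pi * a₁ * cφ / m * P ^ 3 / Rc ≤ 240 * Real.pi * a₁ * cφ / m * (P ^ 4 / Rc) := by
    rw [mul_div_assoc]
    exact mul_le_mul_of_nonneg_left (div_le_div_of_nonneg_right hP34 hRc0.le) (by positivity)
  have ht2 : 15 * a₁ * γ ^ 2 / (2 * m ^ 2) * P ^ 4 / Rc ^ 3 ≤ 15 * a₁ * γ ^ 2 / (2 * m ^ 2) * (P ^ 4 / Rc) := by
    rw [mul_div_assoc]
    exact mul_le_mul_of_nonneg_left (div_le_div_of_nonneg_left (by positivity) hRc0 hRc2) (by positivity)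
  have ht4 : Rc * P / (55296 * Real.pi * m * Rc ^ 3) ≤ 1 / (55296 * Real.pi * m) * (P ^ 4 / Rc) := by
    have e : Rc * P / (55296 * Real.pi * m * Rc ^ 3) = 1 / (55296 * Real.pi * m) * (P / Rc ^ 2) := by
      field_simp
    rw [e]
    have hRc2' : Rc ≤ Rc ^ 2 := by nlinarith
    have h1 : P / Rc ^ 2 ≤ P / Rc := div_le_div_of_nonneg_left hP0.le hRc0 hRc2'
    exact mul_le_mul_of_nonneg_left (h1.trans (div_le_div_of_nonneg_right hP14 hRc0.le)) (by positivity)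
  have hsum : 240 * Real.pi * a₁ * cφ / m * P ^ 3 / Rc + 15 * a₁ * γ ^ 2 / (2 * m ^ 2) * P ^ 4 / Rc ^ 3
      + Rc * P / (55296 * Real.pi * m * Rc ^ 3) ≤ C * (P ^ 4 / Rc) := by
    have e : C * (P ^ 4 / Rc) = 240 * Real.pi * a₁ * cφ / m * (P ^ 4 / Rc) + 15 * a₁ * γ ^ 2 / (2 * m ^ 2) * (P ^ 4 / Rc)
        + 1 / (55296 * Real.pi * m) * (P ^ 4 / Rc) := by rw [hCdef]; ring
    rw [e]; linarith [ht1, ht2, ht4]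
  -- `C P⁴/Rc ≤ C (1+96/γ)⁴ √Rc / Rc = C(1+96/γ)⁴/√Rc ≤ 1/4`
  have hfin : C * (P ^ 4 / Rc) ≤ 1 / 4 := by
    have h1 : C * (P ^ 4 / Rc) ≤ C * ((1 + 96 / γ) ^ 4 * Real.sqrt Rc / Rc) :=
      mul_le_mul_of_nonneg_left (div_le_div_of_nonneg_right hP4 hRc0.le) hC0.le
    have e : C * ((1 + 96 / γ) ^ 4 * Real.sqrt Rc / Rc) = (B / 4) / Real.sqrt Rc := by
      rw [hBdef, eq_div_iff hsq0.ne']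
      have hRe : Real.sqrt Rc * Real.sqrt Rc = Rc := Real.mul_self_sqrt hRc0.le
      have e3 : C * ((1 + 96 / γ) ^ 4 * Real.sqrt Rc / Rc) * Real.sqrt Rc
          = C * (1 + 96 / γ) ^ 4 * ((Real.sqrt Rc * Real.sqrt Rc) / Rc) := by ring
      rw [e3, hRe, div_self hRc0.ne']
      ring
    rw [e] at h1
    have h2 : (B / 4) / Real.sqrt Rc ≤ 1 / 4 := by
      rw [div_le_iff₀ hsq0]; linarith [hsqB]
    exact h1.trans h2
  exact hsum.trans hfin

end Summit.NavierStokesRegularity.NavierStokesRegularity.Theorems.DefectColumnGate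

end
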